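import Literature.Barriers.SmoothPoincare4.ExoticContractibleTheoremAProofs
import Literature.Topology.FourManifolds.CobordismAttachmentExtension
import Literature.Topology.FourManifolds.CollarAttachment
import HarnessLib

/-!
# Akbulut–Ruberman 2016, §3: relative exoticness from invertibility (discharge)

Sibling proof file of `Literature/Barriers/SmoothPoincare4/ExoticContractibleTheoremAProofs.lean`
(fact seat of the tree's barrier `Literature.Barriers.SmoothPoincare4.ContractibleBarrierFour`,
descended to the leaf `akbulutRuberman2016_relativelyExotic` — part (R) of the DAG of
Akbulut–Ruberman's Thm. A).  Everything here is PROVED; no definitions of named facts.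

* `Literature.Barriers.SmoothPoincare4.akbulutRuberman2016_relativelyExotic_holds` —
  **discharge of the named fact `akbulutRuberman2016_relativelyExotic`** (S. Akbulut, D. Ruberman,
  *Absolutely exotic compact 4-manifolds*, Comment. Math. Helv. 91 (2016), §3, proof of Thm. A,
  the paragraph "Write `V′` for `X ∪_f W` … If `V′` were diffeomorphic to `V`, preserving this
  marking, then we could glue this diffeomorphism to the identity of `X̄` to get a diffeomorphism
  `X̄ ∪_N X ∪_f W ≅ W` (E:twist).  But `X̄ ∪_N X ≅ N × I` (relative to the identity on the
  boundary) and hence `f` extends to `X̄ ∪_N X`.  It follows that (E:twist) would result in a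
  diffeomorphism of `(W, f)` with `(W, id)`").  Statement: for `X` an invertible cobordism from
  `∂W` to `N` and any witnesses `V = W ∪_{id} X`, `V′ = W ∪_f X`, a diffeomorphism `Φ : V′ ≅ V`
  preserving the `N`-markings forces `f` to extend to a self-diffeomorphism of `W`.

## The proof (the standard steps left implicit in print)

Let `X′`, `Y = X ∪_N X′` (composite data `D`) and `Θ : Y ≅ ∂W × [0, 1]` rel both ends witness the
invertibility of `X` (Def. 2.1).

1. *Gluing `Φ` to the identity of `X̄ = X′`.*  Extend `V` and `V′` by `X′` inside one and the same
   construction `T = V ∪_N X′`, `T′ = V′ ∪_N X′` (`CobordismAttachmentExtension.lean`: the open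
   gluing of `V - ∂V` (resp. `V′ - ∂V′`) and `Y - inl (∂W)` along the interior of `X`; `T` is at
   the same time an attachment of `X′` to `V` along `∂V = N` and an attachment of `Y` to `W` along
   the identity, and likewise `T′` with `f`).  Through `Φ`, `T` is ALSO an attachment of `X′` to
   `V′` along `∂V′ = N`; by the uniqueness of attachments relative to the far end
   (`CobordismAttachmentUniqueness.lean`, Milnor (1965), Thm. 1.4) there is `Φ̂ : T′ ≅ T` which
   is the identity of `X′` near its far end `∂W` — this is "`Φ ∪ id_{X̄}`" (the isotopy making
   `Φ` collar-compatible near `N` is absorbed in the uniqueness theorem).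
2. *`X̄ ∪_N X ≅ N × I` … hence `X̄ ∪ X ∪ W ≅ W`.*  `W` itself is a witness of `W ∪_{id} Y` (resp.
   `W ∪_f Y`) whose far end is `∂W` marked by the identity (resp. by `f⁻¹`)
   (`CollarAttachment.lean`: `Y ≅ ∂W × I` laid upside down into a collar of `∂W`, `W` pushed in by
   the shrink map).  By uniqueness again, `θ : T ≅ W` and `θ′ : T′ ≅ W` with
   `θ (far m) = incl m`, `θ′ (far m) = incl (f⁻¹ m)`.
3. *(E:twist).*  `F = θ ∘ Φ̂ ∘ θ′⁻¹ : W ≅ W` satisfies `F (incl (f⁻¹ m)) = incl m`, i.e.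
   `F ∘ incl = incl ∘ f`: `f` extends.

If `∂W = ∅` the conclusion is trivial (`f` is the empty map).

## References

* S. Akbulut, D. Ruberman, *Absolutely exotic compact 4-manifolds*, Comment. Math. Helv. 91
  (2016) 1–19, Def. 2.1 and §3 (proof of Thm. A). [AkbulutRuberman2016]
* J. Milnor, *Lectures on the h-cobordism theorem* (1965), §1, Thm. 1.4. [MilnorHCobordism1965]
* M. W. Hirsch, *Differential Topology*, GTM 33 (1976), Ch. 8 §2, Thm. 2.1. [HirschDT1976]
-/

noncomputable section

open scoped Manifold ContDiff
open Function Set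
open Literature.Topology.FourManifolds

namespace Literature.Barriers.SmoothPoincare4

universe u

/-- **Akbulut–Ruberman 2016, §3, part (R): relative exoticness from invertibility — discharge of
the named fact `akbulutRuberman2016_relativelyExotic`.**  For an invertible cobordism `X` from
`∂W` to `N`, any witnesses `A`, `A′` of `V = W ∪_{id} X`, `V′ = W ∪_f X` and any diffeomorphism
`Φ : V′ ≅ V` preserving the `N`-markings, `f` extends to a self-diffeomorphism of `W`.  Proof
(module docstring): extend both by `X′` inside a common witness of `V ∪_N X′ = W ∪ (X ∪_N X′)`,
transport `Φ` to `Φ̂ : V′ ∪ X′ ≅ V ∪ X′` fixing `X′` near its far end (uniqueness of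
attachments), identify `W ∪ (X ∪ X′) ≅ W ∪ (∂W × I) ≅ W` relative to the far end twice
(reference attachment on a collar, uniqueness of attachments), and compose.
[cite: AkbulutRuberman2016, §3, proof of Thm. A (the paragraph "Write V′ for X ∪_f W …")] [cite: MilnorHCobordism1965, §1, Thm. 1.4] -/
theorem akbulutRuberman2016_relativelyExotic_holds : akbulutRuberman2016_relativelyExotic.{u} := by
  intro W _ _ _ _ _ _ b f N _ _ _ X hInv V _ _ _ _ _ V' _ _ _ _ _ A A' hΦ
  obtain ⟨Φ, hΦ⟩ := hΦ
  -- empty boundary: nothing to extend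
  rcases isEmpty_or_nonempty b.carrier with hE | hNE
  · exact ⟨Diffeomorph.refl (𝓡∂ 4) W ∞, fun x => isEmptyElim x⟩
  -- invertibility data: `X′`, the composite `Y = X ∪_N X′` and `Θ : Y ≅ ∂W × I` rel ends
  obtain ⟨X', Y, hcomp, hY⟩ := hInv
  obtain ⟨D⟩ := hcomp.nonempty_compositeData
  haveI : Nonempty X.W := ⟨X.inl (Classical.arbitrary _)⟩
  haveI : CompactSpace V := A.compactSpace
  haveI : CompactSpace V' := A'.compactSpace
  -- Step 1: the common extensions `T = V ∪_N X′`, `T′ = V′ ∪_N X′`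
  let B : CobordismAttachment A.boundaryData X' (Diffeomorph.refl (𝓡 3) N ∞)
      (CobordismAttachment.T A D) := CobordismAttachment.extensionAttachmentX' A D
  let B' : CobordismAttachment A'.boundaryData X' (Diffeomorph.refl (𝓡 3) N ∞)
      (CobordismAttachment.T A' D) := CobordismAttachment.extensionAttachmentX' A' D
  -- through `Φ`, `T` is also an attachment of `X′` to `V′`
  have hΦ' : ∀ y : N, Φ.symm (A.jX (X.inr y)) = A'.jX (X.inr y) := fun y => by
    rw [← hΦ y, Diffeomorph.symm_apply_apply]
  let BΦ : CobordismAttachment A'.boundaryData X' (Diffeomorph.refl (𝓡 3) N ∞)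
      (CobordismAttachment.T A D) :=
    { jW := CobordismAttachment.tV A D ∘ Φ
      jX := B.jX
      isSmoothEmbedding_jW := (CobordismAttachment.isSmoothEmbedding_tV A D).comp_diffeomorph Φ
      isSmoothEmbedding_jX := B.isSmoothEmbedding_jX
      range_union := by
        have hr : range (Φ : V' → V) = univ := Φ.surjective.range_eq
        rw [range_comp, hr, image_univ]
        exact B.range_union
      jW_eq_jX_iff := fun v x' => by
        change B.jW (Φ v) = B.jX x' ↔ _
        rw [B.jW_eq_jX_iff (Φ v) x']
        constructor
        · rintro ⟨y, hy, rfl⟩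
          refine ⟨y, ?_, rfl⟩
          show v = A'.jX (X.inr y)
          rw [← hΦ' y, ← show Φ v = A.jX (X.inr y) from hy, Diffeomorph.symm_apply_apply]
        · rintro ⟨y, rfl, rfl⟩
          exact ⟨y, hΦ y, rfl⟩
      isSmoothEmbedding_jX_comp_inr := B.isSmoothEmbedding_jX_comp_inr
      range_jX_comp_inr := B.range_jX_comp_inr }
  -- `Φ̂ : T′ ≅ T`, the identity of `X′` near its far end
  obtain ⟨Φh, U₁, -, hU₁, hΦh⟩ := CobordismAttachment.exists_diffeomorph_eq_jX_near_inr B' BΦ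
  -- Step 2: `T ≅ W` and `T′ ≅ W` relative to the far end
  obtain ⟨AW, hAW⟩ := CobordismAttachment.exists_referenceAttachment (b := b) hY
    (Diffeomorph.refl (𝓡 3) b.carrier ∞)
  obtain ⟨AW', hAW'⟩ := CobordismAttachment.exists_referenceAttachment (b := b) hY f
  obtain ⟨θ, U₂, -, hU₂, hθ⟩ := CobordismAttachment.exists_diffeomorph_eq_jX_near_inr
    (CobordismAttachment.extensionAttachmentY A D) AW
  obtain ⟨θ', U₃, -, hU₃, hθ'⟩ := CobordismAttachment.exists_diffeomorph_eq_jX_near_inr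
    (CobordismAttachment.extensionAttachmentY A' D) AW'
  -- Step 3: `F = θ ∘ Φ̂ ∘ θ′⁻¹`
  refine ⟨(θ'.symm.trans Φh).trans θ, fun x => ?_⟩
  -- boundary values: `θ′ (far m) = incl (f⁻¹ m)`, `Φ̂ (far m) = far m`, `θ (far m) = incl m`
  have h1 : θ' (CobordismAttachment.tY A' D (Y.inr (f x))) = b.incl x := by
    have := hθ' (Y.inr (f x)) (hU₃ (mem_range_self _))
    rw [CobordismAttachment.extensionAttachmentY_jX] at this
    rw [this, hAW', Diffeomorph.symm_apply_apply]
  have h2 : Φh (CobordismAttachment.tY A' D (Y.inr (f x))) =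
      CobordismAttachment.tY A D (Y.inr (f x)) := by
    have := hΦh (X'.inr (f x)) (hU₁ (mem_range_self _))
    have hl : B'.jX (X'.inr (f x)) = CobordismAttachment.tY A' D (Y.inr (f x)) := by
      show CobordismAttachment.tY A' D (D.j' (X'.inr (f x))) = _
      rw [D.j'_inr]
    have hr : BΦ.jX (X'.inr (f x)) = CobordismAttachment.tY A D (Y.inr (f x)) := by
      show CobordismAttachment.tY A D (D.j' (X'.inr (f x))) = _
      rw [D.j'_inr]
    rw [hl, hr] at this
    exact this
  have h3 : θ (CobordismAttachment.tY A D (Y.inr (f x))) = b.incl (f x) := by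
    have := hθ (Y.inr (f x)) (hU₂ (mem_range_self _))
    rw [CobordismAttachment.extensionAttachmentY_jX] at this
    rw [this, hAW]
    rfl
  show θ (Φh (θ'.symm (b.incl x))) = b.incl (f x)
  rw [← h1, Diffeomorph.symm_apply_apply, h2, h3]

end Literature.Barriers.SmoothPoincare4

end
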